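import Summits.CriticalPhenomena.Ising3DConformalLimit.Theses.LogPolarProxy
import Summits.CriticalPhenomena.Ising3DConformalLimit.Theorems.LogPolarProxyProxyUniversalityLatticeForm

/-!
# Crux `LogPolarProxy.ProxyUniversality` (stmt-CriticalPhenomena-11288) — skeleton `Lines/birth.lean`, v4.1

Line `registered` (birth skeleton of `planner-skel-stmt-CriticalPhenomena-11288-0`, 2026-08-17), led by
`prover-line-stmt-CriticalPhenomena-11288-0` (v1–v3) and the continuation leads
`prover-line-stmt-CriticalPhenomena-11288-c1-0` (v4) and `…-c2-0` (v4.1: stub and composition UNCHANGED; the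
consequence files `…Symmetries`, `…Rotation`, `…Isotropy`, `…IsotropyUpgrade` recorded below). Route `route-CriticalPhenomena-LogPolarProxy`,
sub-problem `Ising3DConformalLimit`. Line card: `Lines/birth.md`; lead's choice: `PICKED.md`.

The crux (UH): for EVERY non-degenerate pointwise scaling limit `(ρ, S)` of the critical `ℤ³` spin
correlators there are row-wise nearest-neighbour coupling profiles `J_r, J_θ, J_φ : ℕ → ℕ → ℝ≥0` and
amplitudes `A : ℕ → ℝ → ℝ>0` such that the renormalised correlators of the FINITE LOG-POLAR PROXY,
`(∏ᵢ A_N(θ(pᵢ)) ρ(δ_N‖pᵢ‖)) · ⟨∏ᵢ σ_{v_N(pᵢ)}⟩_{c_N}`, converge to `S n p` as `N → ∞`, locally uniformly on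
injective configurations off the `z`-axis (`δ_N = π/(N+1)`).

## State of the line (v4): ONE OPEN STUB, A PURE LATTICE–LATTICE COMPARISON, SUFFICIENT FOR THE CRUX

Landed Theorems files of this line (all `--supports stmt-CriticalPhenomena-11288`, axioms
`[propext, Classical.choice, Quot.sound]`, namespace `…Cruxes.ProxyUniversality.Birth`):
* `LogPolarProxyProxyUniversalityDefs.lean` (p150595) — the crux's inlined objects NAMED verbatim (`Idx`,
  `vertex`, `coupling`, `gibbsWeight`, `proxyAvg`, `weight`, `proxyCorr`, `offAxis`), `proxyUniversality_iff :
  ProxyUniversality ↔ <named form> := Iff.rfl`, and the profile-independent API;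
* `LogPolarProxyProxyUniversalityScalingLimitRigidity.lean` (p147345) — S2: two non-degenerate limit pairs of
  `criticalCorr 3` differ by one positive scale (`ρ/ρ' → c`, `S n = cⁿ S' n` on `NonCoincident`);
* `LogPolarProxyProxyUniversalityLimitLocallyBounded.lean` (p148948) — S3: pointwise limits of `criticalCorr 3`
  are locally bounded on `NonCoincident`;
* `LogPolarProxyProxyUniversalitySlices.lean` (p151556) — Z, O: the order-`0` and odd-order slices of the
  proxy convergence hold for EVERY profile and EVERY limit pair;
* `LogPolarProxyProxyUniversalityReduction.lean` (p151838) — gauge transfer, `ProxyUniversality_iff_oneGauge`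
  (crux ⟺ S1), `ProxyUniversality_iff_evenLimit` (crux ⟺ S1', even orders in one gauge);
* `LogPolarProxyProxyUniversalityLatticeForm.lean` (p154629, v4) — the PINNED GAUGE
  `ρ_pin(δ) = ⟨σ₀σ_{⌊1/δ⌋e₀}⟩_{β_c}^{-1/2}` (body of `MoebiusLimitExistsOnlyInteraction.rhoPin`, a function of
  the `ℤ³` model alone, positive at every mesh, renormalising the reference pair `(0,e₀)` to `1` exactly),
  the change of any limit pair to the pinned gauge, the restriction of the `ℤ³` limit to the proxy meshes,
  the difference form, `ProxyUniversality_of_latticeComparison` (**LC_pin → crux**) and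
  `ProxyUniversality_iff_latticeForm` (**crux ⟺ (∃ non-degenerate limit pair) → LC_pin**);
* `LogPolarProxyProxyUniversalitySymmetries.lean` (p155813) / `…Rotation.lean` (p156158) — the EXACT symmetries of
  the proxy: reindexing invariance, radial mirror = unit inversion (`gibbsAvg_radialMirror`,
  `proxyAvg_inv_sq_smul`), azimuthal shift = rotation by `δ_N` about `e₃` (`proxyCorr_rotate`);
* `LogPolarProxyProxyUniversalityIsotropy.lean` (p158316) / `…IsotropyUpgrade.lean` (p158541, lead c2) — the
  ISOTROPY CONSEQUENCES: exact invariance under all multiples of the mesh angle (`proxyCorr_planeRot_natMul`);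
  **crux ⟹ axial rotation invariance of every non-degenerate limit** at off-axis configurations
  (`apply_planeRot_eq_of_proxyUniversality`, continuity at the rotate; `apply_planeRot_ratMulPi_eq_…`, rational
  multiples of `π`, NO continuity); **crux ⟹ `IsRotationInvariant S`** (all of `O(3)`) for every normalised,
  continuous, translation-invariant non-degenerate limit (`isRotationInvariant_of_proxyUniversality`); and the
  LIMIT-FREE necessary condition for the open stub: **LC_pin ⟹ asymptotic azimuthal invariance of the pinned
  critical `ℤ³` correlators along `δ_N`** (`asymptotic_azimuthal_invariance_of_latticeComparison`) — a statement
  about `criticalCorr 3` alone, the disprover's target.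

OPEN (the one registered stub, held by the lead): **LC_pin `stub_latticeComparison`** — there are row-wise
n.n. profiles `J ≥ 0` and amplitudes `A > 0` such that for every EVEN `n ≠ 0` the renormalised proxy
correlator and the rescaled critical `ℤ³` correlator, BOTH in the pinned gauge and at the SAME mesh
`δ_N = π/(N+1)`, differ by `o(1)` as `N → ∞`, locally uniformly on injective off-axis configurations:
`(∏ᵢ A_N(θᵢ) ρ_pin(δ_N‖pᵢ‖)) ⟨∏ᵢ σ_{v_N(pᵢ)}⟩_{proxy,N} − ρ_pin(δ_N)ⁿ ⟨∏ᵢ σ_{⌊pᵢ/δ_N⌋}⟩_{ℤ³,β_c} → 0`.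
No continuum family, no scaling dimension and no gauge freedom occur in it: it compares two lattice
models. It is SUFFICIENT for the crux outright and EQUIVALENT to it as soon as `criticalCorr 3` has a
non-degenerate pointwise scaling limit at all (the hypothesis under which the crux is non-vacuous).

Composition `ProxyUniversality_of : LC_pin → LogPolarProxy.ProxyUniversality` is the landed
`ProxyUniversality_of_latticeComparison`, kernel-checked with NO sorry, concluding the route decl BY NAME over
the alias `__Registered.stub_latticeComparison`; the closing `example` instantiates it with the sorried stub.

Why no proof and no refutation of LC_pin is in reach (lead's census, `NOTES.md ## Census`): LC_pin is the
typed lattice → lattice universality of radial quantisation (BrowerFlemingNeuberger2013; arXiv:2006.15636: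
position-dependent counterterms are needed even numerically); every handle the tree has on the `ℤ³` side
(IR/MMS two-point bounds, `Δ ∈ [1/2,1]`, automatic scale covariance, `m*(β_c) = 0`, GKS/Lebowitz) is
consistent with it, and the exact symmetries of the proxy (azimuthal shift by `δ_N`, radial mirror = unit
inversion, radial transfer matrix) translate LC_pin into isotropy / inversion covariance / sphere
reflection-positivity of the `ℤ³` limit — open, uncontradicted properties. Degenerate profiles (decoupled,
frozen, constant `β_c/2`) are ruled out as witnesses (wrong two-point structure), so a proof needs genuine
control of an inhomogeneous anisotropic critical n.n. model on `Path × Path × Cycle` at separations `≍ N`.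

Disproof used: none exists for this crux (`ledger crux ls`, 2026-08-17).
-/

namespace Summit.CriticalPhenomena.Ising3DConformalLimit.Cruxes.ProxyUniversality.Birth

open scoped BigOperators Topology Classical
open Filter Set Function
open Literature.Probability.LatticeModels
open Summit.CriticalPhenomena.Ising3DConformalLimit.Theses.LogPolarProxy (ProxyUniversality)

/-! ## The registered open stub -/

/-- **LC_pin `stub_latticeComparison` — the log-polar proxy and the cubic lattice have asymptotically equal
renormalised even correlators in the pinned gauge** (OPEN; the physical content of the crux, SUFFICIENT for
it by `ProxyUniversality_of_latticeComparison` and equivalent to it given any non-degenerate limit,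
`ProxyUniversality_iff_latticeForm`): there are row-wise n.n. profiles `J_r, J_θ, J_φ ≥ 0` (resolution `N`,
polar row `j`) and amplitudes `A_N(θ) > 0` such that for every EVEN `n ≠ 0`,
`(∏ᵢ A_N(θᵢ) ρ_pin(δ_N‖pᵢ‖)) ⟨∏ᵢ σ_{v_N(pᵢ)}⟩_{proxy,N} − ρ_pin(δ_N)ⁿ ⟨∏ᵢ σ_{⌊pᵢ/δ_N⌋}⟩_{ℤ³,β_c} → 0` as
`N → ∞`, locally uniformly on injective off-axis configurations, where
`ρ_pin(δ) = ⟨σ₀σ_{⌊1/δ⌋e₀}⟩_{β_c}^{-1/2}` and `δ_N = π/(N+1)`. (Intended profile: row `j` carries the critical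
anisotropic couplings with emergent anisotropy `1 : 1 : 1/sin θ_j`, support item AnisotropicRescaledIsotropy
stmt-CriticalPhenomena-11291, `O(δ²)` counterterms allowed by the `N`-dependence; `A_N(θ)` absorbs the local
Weyl/lattice normalisation.) [BrowerFlemingNeuberger2013; arXiv:2006.15636 (radial lattice quantisation,
position-dependent counterterms); DengBlote2003; ChelkakSmirnov2012] -/
theorem stub_latticeComparison :
    ∃ (Jr Jt Jp : ℕ → ℕ → ℝ) (A : ℕ → ℝ → ℝ), (∀ N j, 0 ≤ Jr N j ∧ 0 ≤ Jt N j ∧ 0 ≤ Jp N j) ∧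
      (∀ N θ, 0 < A N θ) ∧
      ∀ n : ℕ, Even n → n ≠ 0 →
        TendstoLocallyUniformlyOn
          (fun (N : ℕ) (p : Fin n → EuclideanSpace ℝ (Fin 3)) =>
            proxyCorr Jr Jt Jp A
                (fun δ : ℝ => (criticalTwoPoint 3 (Pi.single 0 (⌊1 / δ⌋ : ℤ))) ^ (-(1 / 2 : ℝ))) N n p -
              rescaledCorrelator (criticalCorr 3)
                (fun δ : ℝ => (criticalTwoPoint 3 (Pi.single 0 (⌊1 / δ⌋ : ℤ))) ^ (-(1 / 2 : ℝ))) n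
                (Real.pi / ((N : ℝ) + 1)) p)
          (fun _ => 0) atTop (offAxis n) := by
  sorry

/-! ### The stub statement BY NAME — the hypothesis of `ProxyUniversality_of`

`#h21_check_skeleton` admits a hypothesis of the composing theorem only if its head constant is a registered
obligation or is NAMED like a declared stub; so the registered stub is mirrored by the alias
`abbrev __Registered.stub_latticeComparison : Prop := <the same signature, verbatim>` (definitionally its
statement), and the `example` after the composition instantiates it with the sorried stub. -/
namespace __Registered

/-- Alias of the statement of the registered stub `stub_latticeComparison` (LC_pin), keyed by its name. -/
abbrev stub_latticeComparison : Prop :=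
    ∃ (Jr Jt Jp : ℕ → ℕ → ℝ) (A : ℕ → ℝ → ℝ), (∀ N j, 0 ≤ Jr N j ∧ 0 ≤ Jt N j ∧ 0 ≤ Jp N j) ∧
      (∀ N θ, 0 < A N θ) ∧
      ∀ n : ℕ, Even n → n ≠ 0 →
        TendstoLocallyUniformlyOn
          (fun (N : ℕ) (p : Fin n → EuclideanSpace ℝ (Fin 3)) =>
            proxyCorr Jr Jt Jp A
                (fun δ : ℝ => (criticalTwoPoint 3 (Pi.single 0 (⌊1 / δ⌋ : ℤ))) ^ (-(1 / 2 : ℝ))) N n p -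
              rescaledCorrelator (criticalCorr 3)
                (fun δ : ℝ => (criticalTwoPoint 3 (Pi.single 0 (⌊1 / δ⌋ : ℤ))) ^ (-(1 / 2 : ℝ))) n
                (Real.pi / ((N : ℝ) + 1)) p)
          (fun _ => 0) atTop (offAxis n)

end __Registered

/-! ## Composition (sorry-free): the stub STATEMENT implies the crux, by name -/

/-- **COMPOSITION (v4).** LC_pin → `LogPolarProxy.ProxyUniversality` (item stmt-CriticalPhenomena-11288,
concluded BY NAME): the landed `ProxyUniversality_of_latticeComparison` (pinned-gauge change, restriction of
the `ℤ³` limit to the proxy meshes, difference form, then the v3 reduction `ProxyUniversality_iff_evenLimit`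
— gauge transfer S2/S3 and slices Z/O). -/
theorem ProxyUniversality_of :
    __Registered.stub_latticeComparison →
      Summit.CriticalPhenomena.Ising3DConformalLimit.Theses.LogPolarProxy.ProxyUniversality :=
  fun hL => ProxyUniversality_of_latticeComparison hL

/-- The registered stub discharges the hypothesis of `ProxyUniversality_of` verbatim (an `example`, so no
pre-composed witness of the crux enters the environment; its only `sorry` is the stub's). -/
example : ProxyUniversality :=
  ProxyUniversality_of stub_latticeComparison

/-- Conversely, as soon as the critical `ℤ³` correlators have a non-degenerate pointwise scaling limit at
all, the crux implies the stub (landed equivalence, left to right): nothing is lost in the reduction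
beyond the existence hypothesis under which the crux is non-vacuous. -/
example (hex : ∃ (ρ : ℝ → ℝ) (S : CorrFamily 3), (∀ δ ∈ Set.Ioc (0:ℝ) 1, 0 < ρ δ) ∧
    HasPointwiseScalingLimit (criticalCorr 3) ρ S ∧ IsNondegenerateTwoPoint S) :
    ProxyUniversality → __Registered.stub_latticeComparison :=
  fun h => ProxyUniversality_iff_latticeForm.1 h hex

end Summit.CriticalPhenomena.Ising3DConformalLimit.Cruxes.ProxyUniversality.Birth
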